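import Mathlib
import Summits.ValiantsHypothesis.ValiantsHypothesis.Theses.ValuativeGCT
import Summits.ValiantsHypothesis.ValiantsHypothesis.Theorems.ValuativeGCTValuativeFlipBottomWindow
import Summits.ValiantsHypothesis.ValiantsHypothesis.Theorems.ValuativeGCTNoValuativeFlipBeyondGrenet
import Summits.ValiantsHypothesis.ValiantsHypothesis.Theorems.ValuativeGCTValuativeBound

/-!
# No uniform `m ↦ m + 1` transfer of the valuative flip (crux `ValuativeGCT.ValuativeFlip`,
# stmt-ValiantsHypothesis-12624; wall-breaker axis "representation-stability transfer between `m` and `m + 1`")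

The crux asks, for every `c` and all large `n`, for a valuative flip `dim T_U(λ) < mult_{λ*} ℂ[Δ_m(X₀₀^{m-n} per_n)]`
at EVERY position `n ≤ m ≤ 2^((log₂ n + c)^c)` of the window.  The bottom `m = n` is a theorem
(`valuativeFlip_cruxBody_bottom`, Hilbert-function count), so the cheapest conceivable proof of the crux would be a
STEP TRANSFER "flip at `(n, m)` ⇒ flip at `(n, m + 1)`" iterated up the window (representation stability of both
sides under the padding shift `λ ↦ λ + (δ)`).

`not_uniform_succTransfer` — **no such step can hold uniformly**: for every `n ≥ 3` it is FALSE that the flip body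
transfers from `m` to `m + 1` at every `n ≤ m ≤ 2ⁿ - 2`.  Reason (pure logic over landed theorems): the body holds at
`m = n` (`valuativeFlip_cruxBody_bottom`) and fails at `m = 2ⁿ - 1` (Grenet: `X₀₀^{m-n} per_n ∈ Δ(det_m)`, so
`mult_pp ≤ K_m ≤ dim T_U` by the route's PROVED `ValuativeBound`; `noValuativeFlip_body_of_two_pow_le`), hence
somewhere in between the body holds at `m` and fails at `m + 1` (`exists_flip_not_succ`: a LAST flip position below
Grenet's bound exists for every `n ≥ 3`).  Consequently every `m → m + 1` transfer principle for this crux must be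
CONDITIONAL on the position (e.g. `m` against `n`), never a uniform representation-stability statement.  (The
transfer that DOES hold uniformly lives on the per side of the four-row count — the four-row tangent rank of
`stub_fourRowPencilRank` is realised at every `m ≥ n + 1` by one and the same four-variable pencil, companion file of
this axis — and that stability against the det-side growth `2m² + 2` is exactly why the count stops at `m ≈ √2·n`.)

Sources: K. Mulmuley, M. Sohoni, SIAM J. Comput. 31 (2001) §4–5; B. Grenet, *An upper bound for the permanent versus
determinant problem* (2011); BLMW, SIAM J. Comput. 40 (2011) §5.2; T. Church, J. Ellenberg, B. Farb, Duke Math. J. 164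
(2015) (representation stability, the heuristic being tested); this crux's `Cruxes/ValuativeFlip/STRATEGY-CENSUS.md`.
-/

set_option linter.dupNamespace false

namespace Summit.ValiantsHypothesis.ValiantsHypothesis.Theorems.ValuativeFlip

open scoped BigOperators Matrix
open Literature.NumberTheory.DiophantineGeometry
open Literature.Computability.AlgebraicComplexity
open Summit.ValiantsHypothesis.ValiantsHypothesis.Theses.ValuativeGCT
open Summit.ValiantsHypothesis.ValiantsHypothesis.Theorems.NoValuativeFlip
open Summit.ValiantsHypothesis.ValiantsHypothesis.Theorems.ValuativeBound

noncomputable section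

/-- **The flip body climbs as far as the step transfer lets it.**  If the body of `ValuativeFlip` transfers from
`m` to `m + 1` at every `n ≤ m` with `m + 2 ≤ 2ⁿ` (`n ≥ 3`), then it holds at every `n ≤ k ≤ 2ⁿ - 1` — by induction
from the bottom `valuativeFlip_cruxBody_bottom`.  (Auxiliary; its conclusion at `k = 2ⁿ - 1` is refuted below.)
[this file] -/
theorem flipBody_of_uniform_succTransfer (n : ℕ) (hn : 3 ≤ n)
    (H : ∀ (m : ℕ) [NeZero m], n ≤ m → m + 2 ≤ 2 ^ n →
      (∃ (U : Submodule ℂ (MatIdx m → ℂ)) (r δ : ℕ) (lam : Nat.Partition (m * δ)),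
          (∀ u ∈ U, (Matrix.of fun a b : Fin m => u (toLex (a, b))).rank ≤ r) ∧ lam.parts.card ≤ m * m ∧
            Module.finrank ℂ ↥(MvPolynomial.homogeneousSubmodule (MatIdx m × MatIdx m) ℂ (m * δ) ⊓
                ((MvPolynomial.vanishingIdeal ℂ
                    {p : MatIdx m × MatIdx m → ℂ | ∀ j : MatIdx m, (fun i => p (j, i)) ∈ U}) ^ (δ * (m - r))).restrictScalars ℂ ⊓
                (⨅ (M : Matrix (MatIdx m) (MatIdx m) ℂ)
                  (_ : linSubst (MatIdx m) ℂ M (detFormLex ℂ m) = detFormLex ℂ m),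
                  LinearMap.ker ((MvPolynomial.aeval fun p : MatIdx m × MatIdx m =>
                      ∑ l : MatIdx m, M l p.2 •
                        (MvPolynomial.X (p.1, l) : MvPolynomial (MatIdx m × MatIdx m) ℂ)).toLinearMap -
                    (LinearMap.id : MvPolynomial (MatIdx m × MatIdx m) ℂ →ₗ[ℂ] MvPolynomial (MatIdx m × MatIdx m) ℂ))) ⊓
                (⨅ (g : Matrix.GeneralLinearGroup (MatIdx m) ℂ) (_ : IsUpperTriangular g),
                  LinearMap.ker ((MvPolynomial.aeval fun p : MatIdx m × MatIdx m =>
                      ∑ l : MatIdx m, ((g⁻¹ : Matrix.GeneralLinearGroup (MatIdx m) ℂ) :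
                        Matrix (MatIdx m) (MatIdx m) ℂ) p.1 l •
                          (MvPolynomial.X (l, p.2) : MvPolynomial (MatIdx m × MatIdx m) ℂ)).toLinearMap -
                    weightChar ((Weight.dualOfPartition (m * m) lam).toMatIdx : Weight (MatIdx m)) g •
                      (LinearMap.id : MvPolynomial (MatIdx m × MatIdx m) ℂ →ₗ[ℂ] MvPolynomial (MatIdx m × MatIdx m) ℂ)))) <
              orbitMultiplicity ℂ (paddedPerFormLex ℂ n m) m
                ((Weight.dualOfPartition (m * m) lam).toMatIdx : Weight (MatIdx m))) →
      (∃ (U : Submodule ℂ (MatIdx (m + 1) → ℂ)) (r δ : ℕ) (lam : Nat.Partition ((m + 1) * δ)),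
          (∀ u ∈ U, (Matrix.of fun a b : Fin (m + 1) => u (toLex (a, b))).rank ≤ r) ∧ lam.parts.card ≤ (m + 1) * (m + 1) ∧
            Module.finrank ℂ ↥(MvPolynomial.homogeneousSubmodule (MatIdx (m + 1) × MatIdx (m + 1)) ℂ ((m + 1) * δ) ⊓
                ((MvPolynomial.vanishingIdeal ℂ
                    {p : MatIdx (m + 1) × MatIdx (m + 1) → ℂ | ∀ j : MatIdx (m + 1), (fun i => p (j, i)) ∈ U}) ^ (δ * ((m + 1) - r))).restrictScalars ℂ ⊓
                (⨅ (M : Matrix (MatIdx (m + 1)) (MatIdx (m + 1)) ℂ)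
                  (_ : linSubst (MatIdx (m + 1)) ℂ M (detFormLex ℂ (m + 1)) = detFormLex ℂ (m + 1)),
                  LinearMap.ker ((MvPolynomial.aeval fun p : MatIdx (m + 1) × MatIdx (m + 1) =>
                      ∑ l : MatIdx (m + 1), M l p.2 •
                        (MvPolynomial.X (p.1, l) : MvPolynomial (MatIdx (m + 1) × MatIdx (m + 1)) ℂ)).toLinearMap -
                    (LinearMap.id : MvPolynomial (MatIdx (m + 1) × MatIdx (m + 1)) ℂ →ₗ[ℂ] MvPolynomial (MatIdx (m + 1) × MatIdx (m + 1)) ℂ))) ⊓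
                (⨅ (g : Matrix.GeneralLinearGroup (MatIdx (m + 1)) ℂ) (_ : IsUpperTriangular g),
                  LinearMap.ker ((MvPolynomial.aeval fun p : MatIdx (m + 1) × MatIdx (m + 1) =>
                      ∑ l : MatIdx (m + 1), ((g⁻¹ : Matrix.GeneralLinearGroup (MatIdx (m + 1)) ℂ) :
                        Matrix (MatIdx (m + 1)) (MatIdx (m + 1)) ℂ) p.1 l •
                          (MvPolynomial.X (l, p.2) : MvPolynomial (MatIdx (m + 1) × MatIdx (m + 1)) ℂ)).toLinearMap -
                    weightChar ((Weight.dualOfPartition ((m + 1) * (m + 1)) lam).toMatIdx : Weight (MatIdx (m + 1))) g •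
                      (LinearMap.id : MvPolynomial (MatIdx (m + 1) × MatIdx (m + 1)) ℂ →ₗ[ℂ] MvPolynomial (MatIdx (m + 1) × MatIdx (m + 1)) ℂ)))) <
              orbitMultiplicity ℂ (paddedPerFormLex ℂ n (m + 1)) (m + 1)
                ((Weight.dualOfPartition ((m + 1) * (m + 1)) lam).toMatIdx : Weight (MatIdx (m + 1))))) :
    ∀ (k : ℕ) [NeZero k], n ≤ k → k + 1 ≤ 2 ^ n →
      ∃ (U : Submodule ℂ (MatIdx k → ℂ)) (r δ : ℕ) (lam : Nat.Partition (k * δ)),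
          (∀ u ∈ U, (Matrix.of fun a b : Fin k => u (toLex (a, b))).rank ≤ r) ∧ lam.parts.card ≤ k * k ∧
            Module.finrank ℂ ↥(MvPolynomial.homogeneousSubmodule (MatIdx k × MatIdx k) ℂ (k * δ) ⊓
                ((MvPolynomial.vanishingIdeal ℂ
                    {p : MatIdx k × MatIdx k → ℂ | ∀ j : MatIdx k, (fun i => p (j, i)) ∈ U}) ^ (δ * (k - r))).restrictScalars ℂ ⊓
                (⨅ (M : Matrix (MatIdx k) (MatIdx k) ℂ)
                  (_ : linSubst (MatIdx k) ℂ M (detFormLex ℂ k) = detFormLex ℂ k),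
                  LinearMap.ker ((MvPolynomial.aeval fun p : MatIdx k × MatIdx k =>
                      ∑ l : MatIdx k, M l p.2 •
                        (MvPolynomial.X (p.1, l) : MvPolynomial (MatIdx k × MatIdx k) ℂ)).toLinearMap -
                    (LinearMap.id : MvPolynomial (MatIdx k × MatIdx k) ℂ →ₗ[ℂ] MvPolynomial (MatIdx k × MatIdx k) ℂ))) ⊓
                (⨅ (g : Matrix.GeneralLinearGroup (MatIdx k) ℂ) (_ : IsUpperTriangular g),
                  LinearMap.ker ((MvPolynomial.aeval fun p : MatIdx k × MatIdx k =>
                      ∑ l : MatIdx k, ((g⁻¹ : Matrix.GeneralLinearGroup (MatIdx k) ℂ) :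
                        Matrix (MatIdx k) (MatIdx k) ℂ) p.1 l •
                          (MvPolynomial.X (l, p.2) : MvPolynomial (MatIdx k × MatIdx k) ℂ)).toLinearMap -
                    weightChar ((Weight.dualOfPartition (k * k) lam).toMatIdx : Weight (MatIdx k)) g •
                      (LinearMap.id : MvPolynomial (MatIdx k × MatIdx k) ℂ →ₗ[ℂ] MvPolynomial (MatIdx k × MatIdx k) ℂ)))) <
              orbitMultiplicity ℂ (paddedPerFormLex ℂ n k) k
                ((Weight.dualOfPartition (k * k) lam).toMatIdx : Weight (MatIdx k)) := by
  intro k inst hnk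
  revert inst
  induction k, hnk using Nat.le_induction with
  | base =>
    intro _ _
    exact valuativeFlip_cruxBody_bottom n hn
  | succ k hnk ih =>
    intro _ hk
    haveI hk0 : NeZero k := ⟨by omega⟩
    exact H k hnk (by omega) (ih (by omega))

/-- **No uniform `m ↦ m + 1` transfer of the valuative flip.**  For every `n ≥ 3` it is NOT the case that the body of
`ValuativeGCT.ValuativeFlip` (verbatim: some centre `(U, r)` of ranks `≤ r`, degree `δ`, shape `λ ⊢ mδ` with
`dim T_U(λ) < mult_{λ*} ℂ[Δ_m(X₀₀^{m-n} per_n)]`) passes from `m` to `m + 1` at every position `n ≤ m ≤ 2ⁿ - 2`: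
it holds at `m = n` (bottom count) and fails at `m = 2ⁿ - 1` (Grenet's determinantal representation of the permanent
puts the padded permanent inside `Δ(det_m)`, and `ValuativeBound` is proved).  So any representation-stability /
inheritance principle moving flips from `m` to `m + 1` must depend on the position in the window. [this file;
Grenet 2011; Mulmuley–Sohoni 2001 §4] -/
theorem not_uniform_succTransfer (n : ℕ) (hn : 3 ≤ n) :
    ¬ ∀ (m : ℕ) [NeZero m], n ≤ m → m + 2 ≤ 2 ^ n →
      (∃ (U : Submodule ℂ (MatIdx m → ℂ)) (r δ : ℕ) (lam : Nat.Partition (m * δ)),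
          (∀ u ∈ U, (Matrix.of fun a b : Fin m => u (toLex (a, b))).rank ≤ r) ∧ lam.parts.card ≤ m * m ∧
            Module.finrank ℂ ↥(MvPolynomial.homogeneousSubmodule (MatIdx m × MatIdx m) ℂ (m * δ) ⊓
                ((MvPolynomial.vanishingIdeal ℂ
                    {p : MatIdx m × MatIdx m → ℂ | ∀ j : MatIdx m, (fun i => p (j, i)) ∈ U}) ^ (δ * (m - r))).restrictScalars ℂ ⊓
                (⨅ (M : Matrix (MatIdx m) (MatIdx m) ℂ)
                  (_ : linSubst (MatIdx m) ℂ M (detFormLex ℂ m) = detFormLex ℂ m),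
                  LinearMap.ker ((MvPolynomial.aeval fun p : MatIdx m × MatIdx m =>
                      ∑ l : MatIdx m, M l p.2 •
                        (MvPolynomial.X (p.1, l) : MvPolynomial (MatIdx m × MatIdx m) ℂ)).toLinearMap -
                    (LinearMap.id : MvPolynomial (MatIdx m × MatIdx m) ℂ →ₗ[ℂ] MvPolynomial (MatIdx m × MatIdx m) ℂ))) ⊓
                (⨅ (g : Matrix.GeneralLinearGroup (MatIdx m) ℂ) (_ : IsUpperTriangular g),
                  LinearMap.ker ((MvPolynomial.aeval fun p : MatIdx m × MatIdx m =>
                      ∑ l : MatIdx m, ((g⁻¹ : Matrix.GeneralLinearGroup (MatIdx m) ℂ) :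
                        Matrix (MatIdx m) (MatIdx m) ℂ) p.1 l •
                          (MvPolynomial.X (l, p.2) : MvPolynomial (MatIdx m × MatIdx m) ℂ)).toLinearMap -
                    weightChar ((Weight.dualOfPartition (m * m) lam).toMatIdx : Weight (MatIdx m)) g •
                      (LinearMap.id : MvPolynomial (MatIdx m × MatIdx m) ℂ →ₗ[ℂ] MvPolynomial (MatIdx m × MatIdx m) ℂ)))) <
              orbitMultiplicity ℂ (paddedPerFormLex ℂ n m) m
                ((Weight.dualOfPartition (m * m) lam).toMatIdx : Weight (MatIdx m))) →
      (∃ (U : Submodule ℂ (MatIdx (m + 1) → ℂ)) (r δ : ℕ) (lam : Nat.Partition ((m + 1) * δ)),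
          (∀ u ∈ U, (Matrix.of fun a b : Fin (m + 1) => u (toLex (a, b))).rank ≤ r) ∧ lam.parts.card ≤ (m + 1) * (m + 1) ∧
            Module.finrank ℂ ↥(MvPolynomial.homogeneousSubmodule (MatIdx (m + 1) × MatIdx (m + 1)) ℂ ((m + 1) * δ) ⊓
                ((MvPolynomial.vanishingIdeal ℂ
                    {p : MatIdx (m + 1) × MatIdx (m + 1) → ℂ | ∀ j : MatIdx (m + 1), (fun i => p (j, i)) ∈ U}) ^ (δ * ((m + 1) - r))).restrictScalars ℂ ⊓
                (⨅ (M : Matrix (MatIdx (m + 1)) (MatIdx (m + 1)) ℂ)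
                  (_ : linSubst (MatIdx (m + 1)) ℂ M (detFormLex ℂ (m + 1)) = detFormLex ℂ (m + 1)),
                  LinearMap.ker ((MvPolynomial.aeval fun p : MatIdx (m + 1) × MatIdx (m + 1) =>
                      ∑ l : MatIdx (m + 1), M l p.2 •
                        (MvPolynomial.X (p.1, l) : MvPolynomial (MatIdx (m + 1) × MatIdx (m + 1)) ℂ)).toLinearMap -
                    (LinearMap.id : MvPolynomial (MatIdx (m + 1) × MatIdx (m + 1)) ℂ →ₗ[ℂ] MvPolynomial (MatIdx (m + 1) × MatIdx (m + 1)) ℂ))) ⊓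
                (⨅ (g : Matrix.GeneralLinearGroup (MatIdx (m + 1)) ℂ) (_ : IsUpperTriangular g),
                  LinearMap.ker ((MvPolynomial.aeval fun p : MatIdx (m + 1) × MatIdx (m + 1) =>
                      ∑ l : MatIdx (m + 1), ((g⁻¹ : Matrix.GeneralLinearGroup (MatIdx (m + 1)) ℂ) :
                        Matrix (MatIdx (m + 1)) (MatIdx (m + 1)) ℂ) p.1 l •
                          (MvPolynomial.X (l, p.2) : MvPolynomial (MatIdx (m + 1) × MatIdx (m + 1)) ℂ)).toLinearMap -
                    weightChar ((Weight.dualOfPartition ((m + 1) * (m + 1)) lam).toMatIdx : Weight (MatIdx (m + 1))) g •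
                      (LinearMap.id : MvPolynomial (MatIdx (m + 1) × MatIdx (m + 1)) ℂ →ₗ[ℂ] MvPolynomial (MatIdx (m + 1) × MatIdx (m + 1)) ℂ)))) <
              orbitMultiplicity ℂ (paddedPerFormLex ℂ n (m + 1)) (m + 1)
                ((Weight.dualOfPartition ((m + 1) * (m + 1)) lam).toMatIdx : Weight (MatIdx (m + 1)))) := by
  intro H
  have h8 : 8 ≤ 2 ^ n := by
    calc 8 = 2 ^ 3 := by norm_num
      _ ≤ 2 ^ n := Nat.pow_le_pow_right (by norm_num) hn
  have hlt2 : n < 2 ^ n := Nat.lt_two_pow_self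
  haveI : NeZero (2 ^ n - 1) := ⟨by omega⟩
  have hbody := flipBody_of_uniform_succTransfer n hn H (2 ^ n - 1) (by omega) (by omega)
  obtain ⟨U, r, δ, lam, hU, hcard, hlt⟩ := hbody
  have hle := noValuativeFlip_body_of_two_pow_le ValuativeBound_proof (n := n) (2 ^ n - 1) (by omega) U r hU δ lam hcard
  exact absurd hlt (not_lt.mpr hle)

/-- **A last flip position below Grenet's bound.**  For every `n ≥ 3` there is a position `n ≤ m ≤ 2ⁿ - 2` at which the
body of `ValuativeFlip` HOLDS while it FAILS at `m + 1` (the flip predicate is not monotone in `m`).  Contrapositive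
packaging of `not_uniform_succTransfer`. [this file] -/
theorem exists_flip_not_succ (n : ℕ) (hn : 3 ≤ n) :
    ∃ (m : ℕ) (_ : NeZero m), n ≤ m ∧ m + 2 ≤ 2 ^ n ∧
      (∃ (U : Submodule ℂ (MatIdx m → ℂ)) (r δ : ℕ) (lam : Nat.Partition (m * δ)),
          (∀ u ∈ U, (Matrix.of fun a b : Fin m => u (toLex (a, b))).rank ≤ r) ∧ lam.parts.card ≤ m * m ∧
            Module.finrank ℂ ↥(MvPolynomial.homogeneousSubmodule (MatIdx m × MatIdx m) ℂ (m * δ) ⊓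
                ((MvPolynomial.vanishingIdeal ℂ
                    {p : MatIdx m × MatIdx m → ℂ | ∀ j : MatIdx m, (fun i => p (j, i)) ∈ U}) ^ (δ * (m - r))).restrictScalars ℂ ⊓
                (⨅ (M : Matrix (MatIdx m) (MatIdx m) ℂ)
                  (_ : linSubst (MatIdx m) ℂ M (detFormLex ℂ m) = detFormLex ℂ m),
                  LinearMap.ker ((MvPolynomial.aeval fun p : MatIdx m × MatIdx m =>
                      ∑ l : MatIdx m, M l p.2 •
                        (MvPolynomial.X (p.1, l) : MvPolynomial (MatIdx m × MatIdx m) ℂ)).toLinearMap -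
                    (LinearMap.id : MvPolynomial (MatIdx m × MatIdx m) ℂ →ₗ[ℂ] MvPolynomial (MatIdx m × MatIdx m) ℂ))) ⊓
                (⨅ (g : Matrix.GeneralLinearGroup (MatIdx m) ℂ) (_ : IsUpperTriangular g),
                  LinearMap.ker ((MvPolynomial.aeval fun p : MatIdx m × MatIdx m =>
                      ∑ l : MatIdx m, ((g⁻¹ : Matrix.GeneralLinearGroup (MatIdx m) ℂ) :
                        Matrix (MatIdx m) (MatIdx m) ℂ) p.1 l •
                          (MvPolynomial.X (l, p.2) : MvPolynomial (MatIdx m × MatIdx m) ℂ)).toLinearMap -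
                    weightChar ((Weight.dualOfPartition (m * m) lam).toMatIdx : Weight (MatIdx m)) g •
                      (LinearMap.id : MvPolynomial (MatIdx m × MatIdx m) ℂ →ₗ[ℂ] MvPolynomial (MatIdx m × MatIdx m) ℂ)))) <
              orbitMultiplicity ℂ (paddedPerFormLex ℂ n m) m
                ((Weight.dualOfPartition (m * m) lam).toMatIdx : Weight (MatIdx m))) ∧
      ¬ (∃ (U : Submodule ℂ (MatIdx (m + 1) → ℂ)) (r δ : ℕ) (lam : Nat.Partition ((m + 1) * δ)),
          (∀ u ∈ U, (Matrix.of fun a b : Fin (m + 1) => u (toLex (a, b))).rank ≤ r) ∧ lam.parts.card ≤ (m + 1) * (m + 1) ∧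
            Module.finrank ℂ ↥(MvPolynomial.homogeneousSubmodule (MatIdx (m + 1) × MatIdx (m + 1)) ℂ ((m + 1) * δ) ⊓
                ((MvPolynomial.vanishingIdeal ℂ
                    {p : MatIdx (m + 1) × MatIdx (m + 1) → ℂ | ∀ j : MatIdx (m + 1), (fun i => p (j, i)) ∈ U}) ^ (δ * ((m + 1) - r))).restrictScalars ℂ ⊓
                (⨅ (M : Matrix (MatIdx (m + 1)) (MatIdx (m + 1)) ℂ)
                  (_ : linSubst (MatIdx (m + 1)) ℂ M (detFormLex ℂ (m + 1)) = detFormLex ℂ (m + 1)),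
                  LinearMap.ker ((MvPolynomial.aeval fun p : MatIdx (m + 1) × MatIdx (m + 1) =>
                      ∑ l : MatIdx (m + 1), M l p.2 •
                        (MvPolynomial.X (p.1, l) : MvPolynomial (MatIdx (m + 1) × MatIdx (m + 1)) ℂ)).toLinearMap -
                    (LinearMap.id : MvPolynomial (MatIdx (m + 1) × MatIdx (m + 1)) ℂ →ₗ[ℂ] MvPolynomial (MatIdx (m + 1) × MatIdx (m + 1)) ℂ))) ⊓
                (⨅ (g : Matrix.GeneralLinearGroup (MatIdx (m + 1)) ℂ) (_ : IsUpperTriangular g),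
                  LinearMap.ker ((MvPolynomial.aeval fun p : MatIdx (m + 1) × MatIdx (m + 1) =>
                      ∑ l : MatIdx (m + 1), ((g⁻¹ : Matrix.GeneralLinearGroup (MatIdx (m + 1)) ℂ) :
                        Matrix (MatIdx (m + 1)) (MatIdx (m + 1)) ℂ) p.1 l •
                          (MvPolynomial.X (l, p.2) : MvPolynomial (MatIdx (m + 1) × MatIdx (m + 1)) ℂ)).toLinearMap -
                    weightChar ((Weight.dualOfPartition ((m + 1) * (m + 1)) lam).toMatIdx : Weight (MatIdx (m + 1))) g •
                      (LinearMap.id : MvPolynomial (MatIdx (m + 1) × MatIdx (m + 1)) ℂ →ₗ[ℂ] MvPolynomial (MatIdx (m + 1) × MatIdx (m + 1)) ℂ)))) <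
              orbitMultiplicity ℂ (paddedPerFormLex ℂ n (m + 1)) (m + 1)
                ((Weight.dualOfPartition ((m + 1) * (m + 1)) lam).toMatIdx : Weight (MatIdx (m + 1)))) := by
  by_contra hcon
  apply not_uniform_succTransfer n hn
  intro m inst hnm hm hb
  by_contra hb1
  exact hcon ⟨m, inst, hnm, hm, hb, hb1⟩

end

end Summit.ValiantsHypothesis.ValiantsHypothesis.Theorems.ValuativeFlip
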